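import Mathlib
import Summits.CriticalPhenomena.CardyFormulaZ2.Theorems.CardyMagicRigidityNestingRigidityConeLever
import Summits.CriticalPhenomena.CardyFormulaZ2.Theorems.CardyMagicRigidityNestingRigidityConeTiltLoopSide
import Literature.Probability.Percolation.SiteNestingWeightIntegrable
import Literature.Probability.Percolation.NestingWeightMeasurable
import HarnessLib

/-!
# Crux `NestingRigidity`, line `ring-cloud-tomography` (r4): linearisation of the cone UV factor and
# the reduction of stub R1' `stub_uvDecoupling` to TILTED MOMENTS of an additive loop statistic

Crux `Summit.CriticalPhenomena.CardyFormulaZ2.Theses.CardyMagicRigidity.NestingRigidity`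
(stmt-CriticalPhenomena-4835), line `ring-cloud-tomography`, skeleton r4, stub R1'
`stub_uvDecoupling : ∀ E ∈ latticeEnsembles, UVDecoupling E`.  On both lattices the cone functional
factorises pathwise as `A = w^N · U`, `w = magicWeight t`, `N = N_0(r,1)`, `U = ∏ᶠ_{u ∉ tower} w_u`
(`nestingWeight_coneCloud_eq_latticeEnsembles`), every factor `w_u = 2cos(π/3 + θ_u)` carrying the
phase `θ_u = t(φ_u − ψ_u)`, `|θ_u| ≤ |t| < π/6` (`ConeTilt.abs_cone_nestingPhase_le`).  This file turns
`U` into exponentials of the ADDITIVE statistics `Θ = Σ_{u ∉ tower} θ_u`, `Θ₂ = Σ θ_u²`: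
§1 `exp(−√3θ − θ²/cos(a + π/3)) ≤ 2cos(π/3 + θ) ≤ exp(−√3θ)` for `|θ| ≤ a < π/6`
(`θ ↦ e^{√3θ + κθ²} w(θ)` has derivative `4e^{√3θ + κθ²}(κθ cos(θ + π/3) − sin θ)`);
§2 the PATHWISE UV SANDWICH `exp(−√3 Θ − Θ₂/cos(|t| + π/3)) ≤ U ≤ exp(−√3 Θ)` on both lattices
(honest finite sums over the loops meeting `B̄(0, 2)`);  §3 a tilted Jensen inequality and the
integrability of `A`;  §4 the REDUCTION (registered anchor `uvDecoupling_of_tilted_moments`):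
`UVDecoupling E` follows from one-sided bounds on the `w^N`-tilted first moments
`E[w^N Θ] ≤ (C − t·E N)·E[w^N]`, `E[w^N Θ₂] ≤ C·E[w^N]` (lower bound) and the tilted exponential moment
`E[w^N e^{−√3 Θ}] ≤ C e^{√3 t E N} E[w^N]` (upper bound) — the honest remaining RSW content
(first-moment identity, UV concentration, quasi-multiplicativity), now about an additive functional.
-/
noncomputable section

open MeasureTheory Set Filter Metric
open scoped Real Topology BigOperators

namespace Summit.CriticalPhenomena.CardyFormulaZ2.Cruxes.NestingRigidity.RingCloudTomography

open Literature.Probability.RandomPlanarGeometry Literature.Probability.Percolation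
  Literature.Probability.LatticeModels
open Summit.CriticalPhenomena.CardyFormulaZ2.Cruxes.NestingRigidity.PositiveConeWeightDoubling
  (magicWeight meanTower UVDecoupling coneCloud exists_rpow_lt magicWeight_nonneg_of_mem_cone)

namespace UVLinear

/-! ## §1 Calculus of the weight `w(θ) = 2cos(θ + π/3)` -/

/-- The trigonometric identity behind both bounds: `√3 · w(θ) − 2 sin(θ + π/3) = −4 sin θ`. -/
theorem sqrt_three_mul_magicWeight_sub (θ : ℝ) :
    Real.sqrt 3 * magicWeight θ - 2 * Real.sin (θ + π / 3) = -4 * Real.sin θ := by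
  have h3 : Real.sqrt 3 * Real.sqrt 3 = 3 := Real.mul_self_sqrt (by norm_num)
  rw [magicWeight, Real.cos_add, Real.sin_add, Real.cos_pi_div_three, Real.sin_pi_div_three]
  linear_combination (-Real.sin θ) * h3

/-- A function whose derivative is `≥ 0` on `(0, b)` and `≤ 0` on `(−b, 0)` attains its minimum over
`[−b, b]` at `0`. -/
theorem apply_zero_le_of_deriv {g g' : ℝ → ℝ} {b : ℝ} (hg : ∀ x, HasDerivAt g (g' x) x)
    (hpos : ∀ x ∈ Set.Ioo 0 b, 0 ≤ g' x) (hneg : ∀ x ∈ Set.Ioo (-b) 0, g' x ≤ 0) {x : ℝ}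
    (hx : x ∈ Set.Icc (-b) b) : g 0 ≤ g x := by
  have hc : Continuous g := continuous_iff_continuousAt.2 fun x ↦ (hg x).continuousAt
  rcases le_total 0 x with h0x | hx0
  · have hm : MonotoneOn g (Set.Icc 0 b) :=
      monotoneOn_of_hasDerivWithinAt_nonneg (convex_Icc 0 b) hc.continuousOn
        (fun y _ ↦ (hg y).hasDerivWithinAt) fun y hy ↦ hpos y (by rwa [interior_Icc] at hy)
    exact hm ⟨le_rfl, h0x.trans hx.2⟩ ⟨h0x, hx.2⟩ h0x
  · have hm : AntitoneOn g (Set.Icc (-b) 0) :=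
      antitoneOn_of_hasDerivWithinAt_nonpos (convex_Icc (-b) 0) hc.continuousOn
        (fun y _ ↦ (hg y).hasDerivWithinAt) fun y hy ↦ hneg y (by rwa [interior_Icc] at hy)
    exact hm ⟨hx.1, hx0⟩ ⟨hx.1.trans hx0, le_rfl⟩ hx0

/-- The derivative of `θ ↦ exp(√3 θ + κ θ²) · w(θ)` is `4 exp(√3θ + κθ²)(κ θ cos(θ + π/3) − sin θ)`. -/
theorem hasDerivAt_exp_mul_magicWeight (κ θ : ℝ) :
    HasDerivAt (fun x ↦ Real.exp (Real.sqrt 3 * x + κ * x ^ 2) * magicWeight x)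
      (4 * Real.exp (Real.sqrt 3 * θ + κ * θ ^ 2) *
        (κ * θ * Real.cos (θ + π / 3) - Real.sin θ)) θ := by
  have h1 : HasDerivAt (fun x ↦ Real.sqrt 3 * x + κ * x ^ 2) (Real.sqrt 3 * 1 + κ * (2 * θ ^ 1 * 1)) θ :=
    ((hasDerivAt_id' θ).const_mul (Real.sqrt 3)).add (((hasDerivAt_id' θ).pow 2).const_mul κ)
  have h2 : HasDerivAt magicWeight (2 * (-Real.sin (θ + π / 3) * 1)) θ := by
    unfold magicWeight
    exact ((Real.hasDerivAt_cos (θ + π / 3)).comp θ ((hasDerivAt_id' θ).add_const (π / 3))).const_mul 2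
  refine (h1.exp.mul h2).congr_deriv ?_
  have key := sqrt_three_mul_magicWeight_sub θ
  have hw : magicWeight θ = 2 * Real.cos (θ + π / 3) := rfl
  linear_combination Real.exp (Real.sqrt 3 * θ + κ * θ ^ 2) * key +
    (2 * κ * θ * Real.exp (Real.sqrt 3 * θ + κ * θ ^ 2)) * hw

/-- **Upper linearisation**: `w(θ) ≤ exp(−√3 θ)` for `|θ| ≤ π` (`κ = 0`: derivative `−4e^{√3θ} sin θ`). -/
theorem magicWeight_le_exp {θ : ℝ} (hθ : |θ| ≤ π) : magicWeight θ ≤ Real.exp (-(Real.sqrt 3 * θ)) := by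
  have hd : ∀ x, HasDerivAt (fun x ↦ -(Real.exp (Real.sqrt 3 * x + 0 * x ^ 2) * magicWeight x))
      (-(4 * Real.exp (Real.sqrt 3 * x + 0 * x ^ 2) * (0 * x * Real.cos (x + π / 3) - Real.sin x)))
      x := fun x ↦ (hasDerivAt_exp_mul_magicWeight 0 x).neg
  have hsgn : ∀ x, -(4 * Real.exp (Real.sqrt 3 * x + 0 * x ^ 2) *
      (0 * x * Real.cos (x + π / 3) - Real.sin x)) = 4 * Real.exp (Real.sqrt 3 * x + 0 * x ^ 2) * Real.sin x :=
    fun x ↦ by ring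
  have h := apply_zero_le_of_deriv hd
    (fun x hx ↦ (hsgn x).symm ▸ mul_nonneg (by positivity) (Real.sin_nonneg_of_nonneg_of_le_pi hx.1.le hx.2.le))
    (fun x hx ↦ (hsgn x).symm ▸ mul_nonpos_of_nonneg_of_nonpos (by positivity)
      (Real.sin_nonpos_of_nonpos_of_neg_pi_le hx.2.le hx.1.le)) (abs_le.1 hθ)
  simp only [mul_zero, zero_mul, add_zero, Real.exp_zero, one_mul, neg_le_neg_iff] at h
  rw [show magicWeight 0 = 1 by rw [magicWeight, zero_add, Real.cos_pi_div_three]; norm_num] at h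
  calc magicWeight θ = Real.exp (-(Real.sqrt 3 * θ)) * (Real.exp (Real.sqrt 3 * θ) * magicWeight θ) := by
        rw [← mul_assoc, ← Real.exp_add, neg_add_cancel, Real.exp_zero, one_mul]
    _ ≤ Real.exp (-(Real.sqrt 3 * θ)) * 1 := mul_le_mul_of_nonneg_left h (Real.exp_pos _).le
    _ = _ := mul_one _

/-- **Lower linearisation with Gaussian correction**: `exp(−√3 θ − θ²/cos(a + π/3)) ≤ w(θ)` for
`|θ| ≤ a < π/6` (on `[−a, a]`, `cos(θ + π/3) ≥ cos(a + π/3) > 0` and `|sin θ| ≤ |θ|`). -/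
theorem exp_le_magicWeight {a θ : ℝ} (ha : a < π / 6) (hθ : |θ| ≤ a) :
    Real.exp (-(Real.sqrt 3 * θ) - θ ^ 2 / Real.cos (a + π / 3)) ≤ magicWeight θ := by
  have ha0 : 0 ≤ a := (abs_nonneg θ).trans hθ
  set c := Real.cos (a + π / 3) with hc
  have hcpos : 0 < c := Real.cos_pos_of_mem_Ioo ⟨by linarith [Real.pi_pos], by linarith⟩
  have hcos : ∀ x ∈ Set.Icc (-a) a, 1 ≤ Real.cos (x + π / 3) / c := fun x hx ↦
    (one_le_div hcpos).2 (Real.cos_le_cos_of_nonneg_of_le_pi (by linarith [hx.1, Real.pi_pos])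
      (by linarith [Real.pi_pos]) (by linarith [hx.2]))
  have hd := hasDerivAt_exp_mul_magicWeight c⁻¹
  have h := apply_zero_le_of_deriv hd (fun x hx ↦ ?_) (fun x hx ↦ ?_) (abs_le.1 hθ)
  · simp only [mul_zero, add_zero, Real.exp_zero, one_mul, ne_eq, OfNat.ofNat_ne_zero,
      not_false_eq_true, zero_pow] at h
    rw [show magicWeight 0 = 1 by rw [magicWeight, zero_add, Real.cos_pi_div_three]; norm_num] at h
    calc Real.exp (-(Real.sqrt 3 * θ) - θ ^ 2 / c)
        = Real.exp (-(Real.sqrt 3 * θ) - θ ^ 2 / c) * 1 := (mul_one _).symm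
      _ ≤ Real.exp (-(Real.sqrt 3 * θ) - θ ^ 2 / c) *
            (Real.exp (Real.sqrt 3 * θ + c⁻¹ * θ ^ 2) * magicWeight θ) :=
          mul_le_mul_of_nonneg_left h (Real.exp_pos _).le
      _ = magicWeight θ := by
          rw [← mul_assoc, ← Real.exp_add, div_eq_mul_inv,
            show -(Real.sqrt 3 * θ) - θ ^ 2 * c⁻¹ + (Real.sqrt 3 * θ + c⁻¹ * θ ^ 2) = 0 by ring,
            Real.exp_zero, one_mul]
  · have h1 : x * 1 ≤ x * (Real.cos (x + π / 3) / c) :=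
      mul_le_mul_of_nonneg_left (hcos x ⟨by linarith [hx.1], hx.2.le⟩) hx.1.le
    rw [div_eq_mul_inv] at h1
    have h2 : Real.sin x ≤ x := Real.sin_le hx.1.le
    exact mul_nonneg (by positivity) (by nlinarith)
  · have h1 : x * (Real.cos (x + π / 3) / c) ≤ x * 1 :=
      mul_le_mul_of_nonpos_left (hcos x ⟨hx.1.le, by linarith [hx.2]⟩) hx.2.le
    rw [div_eq_mul_inv] at h1
    have h2 : x ≤ Real.sin x := by
      have := Real.sin_le (neg_nonneg.2 hx.2.le); rw [Real.sin_neg] at this; linarith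
    exact mul_nonpos_of_nonneg_of_nonpos (by positivity) (by nlinarith)

/-- The finite-product form of the sandwich: for finitely many loops whose phases against `f` are
bounded by `a < π/6`, `exp(−√3 Σθ − (Σθ²)/cos(a + π/3)) ≤ ∏ w_u ≤ exp(−√3 Σθ)`. -/
theorem prod_nestingFactor_mem_Icc (S : Finset (UnbasedLoop ℂ)) (f : ℂ → ℝ) {a : ℝ} (ha : a < π / 6)
    (hθ : ∀ u ∈ S, |UnbasedLoop.nestingPhase f u| ≤ a) :
    Real.exp (-(Real.sqrt 3 * ∑ u ∈ S, UnbasedLoop.nestingPhase f u) -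
        (∑ u ∈ S, UnbasedLoop.nestingPhase f u ^ 2) / Real.cos (a + π / 3)) ≤
        ∏ u ∈ S, UnbasedLoop.nestingFactor f u ∧
      ∏ u ∈ S, UnbasedLoop.nestingFactor f u ≤
        Real.exp (-(Real.sqrt 3 * ∑ u ∈ S, UnbasedLoop.nestingPhase f u)) := by
  have hfac : ∀ u, UnbasedLoop.nestingFactor f u = magicWeight (UnbasedLoop.nestingPhase f u) :=
    fun u ↦ rfl
  have hπ : ∀ u ∈ S, |UnbasedLoop.nestingPhase f u| ≤ π := fun u hu ↦
    (hθ u hu).trans (by linarith [Real.pi_pos])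
  simp only [hfac]
  constructor
  · rw [show -(Real.sqrt 3 * ∑ u ∈ S, UnbasedLoop.nestingPhase f u) -
        (∑ u ∈ S, UnbasedLoop.nestingPhase f u ^ 2) / Real.cos (a + π / 3) =
        ∑ u ∈ S, (-(Real.sqrt 3 * UnbasedLoop.nestingPhase f u) -
          UnbasedLoop.nestingPhase f u ^ 2 / Real.cos (a + π / 3)) by
      rw [Finset.sum_sub_distrib, Finset.sum_div, Finset.mul_sum, Finset.sum_neg_distrib],
      Real.exp_sum]
    exact Finset.prod_le_prod (fun u _ ↦ (Real.exp_pos _).le) fun u hu ↦ exp_le_magicWeight ha (hθ u hu)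
  · rw [show -(Real.sqrt 3 * ∑ u ∈ S, UnbasedLoop.nestingPhase f u) =
        ∑ u ∈ S, -(Real.sqrt 3 * UnbasedLoop.nestingPhase f u) by
      rw [Finset.mul_sum, Finset.sum_neg_distrib], Real.exp_sum]
    exact Finset.prod_le_prod
      (fun u hu ↦ (exp_le_magicWeight ha (hθ u hu)).trans' (Real.exp_pos _).le)
      fun u hu ↦ magicWeight_le_exp (hπ u hu)

/-! ## §2 The pathwise UV sandwich on both lattice ensembles -/

/-- Against the cone density a loop NOT meeting `B̄(0, 2)` has phase `0` (so weight `1`). -/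
theorem cone_nestingPhase_eq_zero {t r : ℝ} (hr : 0 < r) (hr1 : r ≤ 1) {u : UnbasedLoop ℂ}
    (hu : ¬ (u.range ∩ closedBall (0 : ℂ) 2).Nonempty) : u.nestingPhase (coneCloud t r).density = 0 :=
  nestingPhase_eq_zero_of_disjoint (fun _ hz ↦ ConeTilt.cone_density_eq_zero rfl (by linarith) hz)
    (ConeTilt.integral_cone_density rfl hr hr1)
    (Set.disjoint_iff_inter_eq_empty.2 (Set.not_nonempty_iff_eq_empty.1 hu))

/-- **Pathwise UV sandwich on both lattices.**  For `E ∈ latticeEnsembles`, mesh `δ > 0`, `|t| < π/6`,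
`0 < r ≤ 1`: with `L \ T` the non-tower loops of `X_δ(ω)`, `U = ∏ᶠ_{L∖T} w_u`, `Θ = ∑ᶠ_{L∖T} θ_u`,
`Θ₂ = ∑ᶠ_{L∖T} θ_u²` (honest finite products/sums: only loops meeting `B̄(0,2)` contribute),
`exp(−√3 Θ − Θ₂/cos(|t| + π/3)) ≤ U ≤ exp(−√3 Θ)`. -/
theorem finprod_nestingFactor_mem_Icc : ∀ E ∈ latticeEnsembles, ∀ {δ : ℝ}, 0 < δ → ∀ (ω : E.Ω)
    {t r : ℝ}, |t| < π / 6 → 0 < r → r ≤ 1 → ∀ T : Set (UnbasedLoop ℂ),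
    Real.exp (-(Real.sqrt 3 * ∑ᶠ u ∈ (E.X δ ω).loops \ T, u.nestingPhase (coneCloud t r).density) -
        (∑ᶠ u ∈ (E.X δ ω).loops \ T, u.nestingPhase (coneCloud t r).density ^ 2) /
          Real.cos (|t| + π / 3)) ≤
        ∏ᶠ u ∈ (E.X δ ω).loops \ T, u.nestingFactor (coneCloud t r).density ∧
      ∏ᶠ u ∈ (E.X δ ω).loops \ T, u.nestingFactor (coneCloud t r).density ≤
        Real.exp (-(Real.sqrt 3 * ∑ᶠ u ∈ (E.X δ ω).loops \ T, u.nestingPhase (coneCloud t r).density)) := by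
  intro E hE δ hδ ω t r ht hr hr1 T
  set f := (coneCloud t r).density with hf
  set M := {u ∈ (E.X δ ω).loops | (u.range ∩ closedBall (0 : ℂ) 2).Nonempty} with hM
  have hfin : ((E.X δ ω).loops \ T ∩ M).Finite :=
    (ConeTilt.finite_loops_meeting E hE hδ ω 2).subset Set.inter_subset_right
  set S := hfin.toFinset with hS
  -- off `M` the phase vanishes, so all three finitary operations localise to `S`
  have hθ0 : ∀ u ∈ (E.X δ ω).loops \ T, u ∉ (E.X δ ω).loops \ T ∩ M → u.nestingPhase f = 0 :=
    fun u hu hu' ↦ cone_nestingPhase_eq_zero hr hr1 fun h ↦ hu' ⟨hu, hu.1, h⟩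
  have loc : ∀ g : UnbasedLoop ℂ → ℝ, (∀ u, u.nestingPhase f = 0 → g u = 0) →
      ∑ᶠ u ∈ (E.X δ ω).loops \ T, g u = ∑ u ∈ S, g u := fun g hg ↦ by
    rw [finsum_mem_inter_support_eq' g ((E.X δ ω).loops \ T) ((E.X δ ω).loops \ T ∩ M)
      fun u hu ↦ ⟨fun h ↦ by_contra fun h' ↦ hu (hg u (hθ0 u h h')), fun h ↦ h.1⟩,
      finsum_mem_eq_finite_toFinset_sum g hfin]
  have locp : ∏ᶠ u ∈ (E.X δ ω).loops \ T, u.nestingFactor f = ∏ u ∈ S, u.nestingFactor f := by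
    rw [finprod_mem_inter_mulSupport_eq' _ ((E.X δ ω).loops \ T) ((E.X δ ω).loops \ T ∩ M)
      fun u hu ↦ ⟨fun h ↦ by_contra fun h' ↦ hu
        (UnbasedLoop.nestingFactor_eq_one_of_nestingPhase_eq_zero (hθ0 u h h')), fun h ↦ h.1⟩,
      finprod_mem_eq_finite_toFinset_prod _ hfin]
  rw [loc (fun u ↦ u.nestingPhase f) fun u h ↦ h,
    loc (fun u ↦ u.nestingPhase f ^ 2) fun u h ↦ by rw [h]; ring, locp]
  exact prod_nestingFactor_mem_Icc S f ht fun u _ ↦ ConeTilt.abs_cone_nestingPhase_le rfl hr u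

/-! ## §3 Tilted Jensen and integrability of the cone functional -/

/-- **Tilted Jensen (tangent line of `exp`).**  For a weight `g ≥ 0` with `∫ g > 0` and an integrable
`g·X`, every integrable majorant `F ≥ g·e^X` has `∫ F ≥ (∫ g) · exp((∫ g X)/(∫ g))`. -/
theorem mul_exp_div_le_integral {Ω : Type*} [MeasurableSpace Ω] {μ : Measure Ω} {g X F : Ω → ℝ}
    (hg : ∀ ω, 0 ≤ g ω) (hgi : Integrable g μ) (hgX : Integrable (fun ω ↦ g ω * X ω) μ)
    (hpos : 0 < ∫ ω, g ω ∂μ) (hF : Integrable F μ) (hle : ∀ ω, g ω * Real.exp (X ω) ≤ F ω) :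
    (∫ ω, g ω ∂μ) * Real.exp ((∫ ω, g ω * X ω ∂μ) / ∫ ω, g ω ∂μ) ≤ ∫ ω, F ω ∂μ := by
  set a := (∫ ω, g ω * X ω ∂μ) / ∫ ω, g ω ∂μ with ha
  have hpt : ∀ ω, Real.exp a * (g ω + (g ω * X ω - a * g ω)) ≤ F ω := fun ω ↦ by
    refine le_trans ?_ (hle ω)
    have h1 : (X ω - a) + 1 ≤ Real.exp (X ω - a) := Real.add_one_le_exp _
    have h2 : Real.exp (X ω) = Real.exp a * Real.exp (X ω - a) := by rw [← Real.exp_add]; ring_nf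
    rw [h2]
    nlinarith [mul_le_mul_of_nonneg_left h1 (hg ω), Real.exp_pos a]
  have hsub : Integrable (fun ω ↦ g ω * X ω - a * g ω) μ := hgX.sub (hgi.const_mul a)
  have hadd : Integrable (fun ω ↦ g ω + (g ω * X ω - a * g ω)) μ := hgi.add hsub
  have hint : Integrable (fun ω ↦ Real.exp a * (g ω + (g ω * X ω - a * g ω))) μ := hadd.const_mul _
  calc (∫ ω, g ω ∂μ) * Real.exp a
      = Real.exp a * ((∫ ω, g ω ∂μ) + ((∫ ω, g ω * X ω ∂μ) - a * ∫ ω, g ω ∂μ)) := by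
        rw [ha, div_mul_cancel₀ _ hpos.ne']; ring
    _ = ∫ ω, Real.exp a * (g ω + (g ω * X ω - a * g ω)) ∂μ := by
        rw [integral_const_mul, integral_add hgi hsub, integral_sub hgX (hgi.const_mul a),
          integral_const_mul]
    _ ≤ ∫ ω, F ω ∂μ := integral_mono hint hF hpt

/-- **The cone functional is integrable on both lattices** at every mesh `δ > 0` (bounded by
`2^{N(δ)}`, measurable: `SiteNestingWeightIntegrable`, `NestingWeightMeasurable`). -/
theorem integrable_nestingWeight_cone : ∀ E ∈ latticeEnsembles, ∀ {δ : ℝ}, 0 < δ → ∀ (t : ℝ) {r : ℝ},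
    0 < r → r ≤ 1 → Integrable (fun ω ↦ (E.X δ ω).nestingWeight (coneCloud t r).density) E.P := by
  intro E hE δ hδ t r hr hr1
  have hR : ∀ z : ℂ, 2 < ‖z‖ → (coneCloud t r).density z = 0 := fun z hz ↦
    ConeTilt.cone_density_eq_zero rfl (by linarith) hz
  have h0 := ConeTilt.integral_cone_density (𝔠 := coneCloud t r) rfl hr hr1
  haveI := isProbabilityMeasure_of_mem hE
  simp only [latticeEnsembles, Set.mem_insert_iff, Set.mem_singleton_iff] at hE
  rcases hE with rfl | rfl
  · exact Integrable.mono' (integrable_const _)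
      (measurable_nestingWeight_bondLoopConfig _ δ).aestronglyMeasurable
      (Eventually.of_forall fun ω ↦ by
        rw [Real.norm_eq_abs]; exact abs_nestingWeight_bondLoopConfig_le hR h0 hδ ω)
  · exact integrable_nestingWeight_siteLoopConfig hR h0 hδ (triSitePercolation half)

/-- In the open cone the tilted tower moment is positive at every mesh `δ > 0`:
`0 < E_δ[w(t)^{N_0(r,1)}]` (`w(t) > 0`, probability law). -/
theorem towerMoment_pos : ∀ E ∈ latticeEnsembles, ∀ {t δ : ℝ}, |t| < π / 6 → 0 < δ → ∀ r : ℝ,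
    0 < E.towerMoment (magicWeight t) δ r := by
  intro E hE t δ ht hδ r
  haveI := isProbabilityMeasure_of_mem hE
  have hw : 0 < magicWeight t := mul_pos two_pos (Real.cos_pos_of_mem_Ioo
    ⟨by linarith [abs_lt.1 ht, Real.pi_pos], by linarith [(abs_lt.1 ht).2]⟩)
  rw [LoopEnsemble.towerMoment, integral_pos_iff_support_of_nonneg (fun ω ↦ pow_nonneg hw.le _)
    (ConeTilt.integrable_pow_towerCount_of_nonneg E hE _ hδ 0 r 1 hw.le),
    show Function.support (fun ω ↦ magicWeight t ^ towerCount (E.X δ ω) 0 r 1) = Set.univ from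
      Set.eq_univ_of_forall fun ω ↦ (pow_pos hw _).ne', measure_univ]
  exact one_pos

end UVLinear

/-! ## §4 The reduction of `UVDecoupling` to tilted moments of the additive UV statistic -/

/-- **`UVDecoupling E` from tilted moments of the additive UV statistic** (registered helper toward
stub R1' `stub_uvDecoupling`, line `ring-cloud-tomography` r4).  Write `w = magicWeight t`,
`N = N_0(r,1)`, `M = E_δ[w^N]`, `m = E_δ[N]`, and let `Θ = Σ_{u ∉ tower} θ_u`, `Θ₂ = Σ_{u ∉ tower} θ_u²`
be the sums of the (squared) phases of the NON-tower loops against the cone density (pinned below by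
equations, `∑ᶠ` over `loops ∖ tower`).  If, for every `t` in the cone, with a constant `C = C(t)`, for
all small `r` and then all small meshes,
(LOWER INPUT) `E_δ[w^N Θ] ≤ (C − t m) M` and `E_δ[w^N Θ₂] ≤ C M` (one-sided tilted first moments:
the first-moment identity `E[Σ(φ − ψ)] = −m + O(1)` under the tilt, and tightness of `Σ θ²`), and
(UPPER INPUT) `E_δ[w^N e^{−√3 Θ}] ≤ C e^{√3 t m} M` (tilted exponential concentration of `Θ`), then
`UVDecoupling E`: pathwise `w^N e^{−√3Θ − Θ₂/cos(|t|+π/3)} ≤ A ≤ w^N e^{−√3Θ}`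
(`UVLinear.finprod_nestingFactor_mem_Icc`), the lower bound by the tilted Jensen inequality, the
upper bound by monotonicity; constants are absorbed into `r^{±η}`. -/
theorem uvDecoupling_of_tilted_moments : ∀ E ∈ latticeEnsembles,
    (∀ t ∈ Set.Ioo (-(π / 6)) (π / 6), ∃ C r₀ : ℝ, 0 < r₀ ∧ ∀ r ∈ Set.Ioo (0 : ℝ) r₀,
      ∀ᶠ δ in 𝓝[>] (0 : ℝ), ∀ Θ Θ₂ : E.Ω → ℝ,
        (∀ ω, Θ ω = ∑ᶠ u ∈ (E.X δ ω).loops \ {u ∈ (E.X δ ω).loops |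
            Metric.closedBall (0 : ℂ) r ⊆ {z | u.wind z ≠ 0} ∧ u.range ⊆ Metric.ball (0 : ℂ) 1},
            u.nestingPhase (coneCloud t r).density) →
        (∀ ω, Θ₂ ω = ∑ᶠ u ∈ (E.X δ ω).loops \ {u ∈ (E.X δ ω).loops |
            Metric.closedBall (0 : ℂ) r ⊆ {z | u.wind z ≠ 0} ∧ u.range ⊆ Metric.ball (0 : ℂ) 1},
            u.nestingPhase (coneCloud t r).density ^ 2) →
        Integrable (fun ω ↦ magicWeight t ^ towerCount (E.X δ ω) 0 r 1 * Θ ω) E.P ∧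
        Integrable (fun ω ↦ magicWeight t ^ towerCount (E.X δ ω) 0 r 1 * Θ₂ ω) E.P ∧
        ∫ ω, magicWeight t ^ towerCount (E.X δ ω) 0 r 1 * Θ ω ∂E.P ≤
          (C - t * meanTower E δ r) * E.towerMoment (magicWeight t) δ r ∧
        ∫ ω, magicWeight t ^ towerCount (E.X δ ω) 0 r 1 * Θ₂ ω ∂E.P ≤
          C * E.towerMoment (magicWeight t) δ r) →
    (∀ t ∈ Set.Ioo (-(π / 6)) (π / 6), ∃ C r₀ : ℝ, 0 < r₀ ∧ ∀ r ∈ Set.Ioo (0 : ℝ) r₀,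
      ∀ᶠ δ in 𝓝[>] (0 : ℝ), ∀ Θ : E.Ω → ℝ,
        (∀ ω, Θ ω = ∑ᶠ u ∈ (E.X δ ω).loops \ {u ∈ (E.X δ ω).loops |
            Metric.closedBall (0 : ℂ) r ⊆ {z | u.wind z ≠ 0} ∧ u.range ⊆ Metric.ball (0 : ℂ) 1},
            u.nestingPhase (coneCloud t r).density) →
        Integrable (fun ω ↦ magicWeight t ^ towerCount (E.X δ ω) 0 r 1 *
          Real.exp (-(Real.sqrt 3 * Θ ω))) E.P ∧
        ∫ ω, magicWeight t ^ towerCount (E.X δ ω) 0 r 1 * Real.exp (-(Real.sqrt 3 * Θ ω)) ∂E.P ≤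
          C * Real.exp (Real.sqrt 3 * t * meanTower E δ r) * E.towerMoment (magicWeight t) δ r) →
    UVDecoupling E := by
  intro E hE hlow hup t ht η hη
  obtain ⟨C₁, r₁, hr₁, h₁⟩ := hlow t ht
  obtain ⟨C₂, r₂, hr₂, h₂⟩ := hup t ht
  have htabs : |t| < π / 6 := abs_lt.2 ht
  have hw0 : 0 ≤ magicWeight t := (magicWeight_nonneg_of_mem_cone ht).1
  set c : ℝ := Real.cos (|t| + π / 3) with hc
  have hcpos : 0 < c := Real.cos_pos_of_mem_Ioo ⟨by linarith [abs_nonneg t, Real.pi_pos], by linarith⟩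
  set K₁ : ℝ := Real.sqrt 3 * C₁ + C₁ / c with hK₁
  have hK₂ : 0 < max C₂ 1 := lt_max_of_lt_right one_pos
  obtain ⟨r₃, hr₃, hsmall⟩ := exists_rpow_lt hη (lt_min (Real.exp_pos (-K₁)) (inv_pos.2 hK₂))
  refine ⟨min (min r₁ r₂) (min r₃ 1), lt_min (lt_min hr₁ hr₂) (lt_min hr₃ one_pos), fun r hr ↦ ?_⟩
  have hr0 : 0 < r := hr.1
  have hr1 : r ≤ 1 := (hr.2.trans_le ((min_le_right _ _).trans (min_le_right _ _))).le
  have hrη : 0 < r ^ η := Real.rpow_pos_of_pos hr0 η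
  have hsm := hsmall r ⟨hr0, hr.2.trans_le ((min_le_right _ _).trans (min_le_left _ _))⟩
  filter_upwards [h₁ r ⟨hr0, hr.2.trans_le ((min_le_left _ _).trans (min_le_left _ _))⟩,
    h₂ r ⟨hr0, hr.2.trans_le ((min_le_left _ _).trans (min_le_right _ _))⟩,
    self_mem_nhdsWithin] with δ hδ₁ hδ₂ hδ
  rw [Set.mem_Ioi] at hδ
  -- the statistics `Θ`, `Θ₂`, the tower weight `g = w^N`, the functional `A`, the pathwise sandwich
  set T : E.Ω → Set (UnbasedLoop ℂ) := fun ω ↦ {u ∈ (E.X δ ω).loops |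
    Metric.closedBall (0 : ℂ) r ⊆ {z | u.wind z ≠ 0} ∧ u.range ⊆ Metric.ball (0 : ℂ) 1}
  set Θ : E.Ω → ℝ := fun ω ↦ ∑ᶠ u ∈ (E.X δ ω).loops \ T ω, u.nestingPhase (coneCloud t r).density
  set Θ₂ : E.Ω → ℝ := fun ω ↦ ∑ᶠ u ∈ (E.X δ ω).loops \ T ω, u.nestingPhase (coneCloud t r).density ^ 2
  set g : E.Ω → ℝ := fun ω ↦ magicWeight t ^ towerCount (E.X δ ω) 0 r 1
  set A : E.Ω → ℝ := fun ω ↦ (E.X δ ω).nestingWeight (coneCloud t r).density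
  obtain ⟨hiΘ, hiΘ₂, hmΘ, hmΘ₂⟩ := hδ₁ Θ Θ₂ (fun _ ↦ rfl) (fun _ ↦ rfl)
  obtain ⟨hiE, hmE⟩ := hδ₂ Θ (fun _ ↦ rfl)
  have hg0 : ∀ ω, 0 ≤ g ω := fun ω ↦ pow_nonneg hw0 _
  have hA : ∀ ω, A ω = g ω * ∏ᶠ u ∈ (E.X δ ω).loops \ T ω, u.nestingFactor (coneCloud t r).density :=
    fun ω ↦ nestingWeight_coneCloud_eq_latticeEnsembles E hE hδ ω t hr0 hr1
  have hUV := fun ω ↦ UVLinear.finprod_nestingFactor_mem_Icc E hE hδ ω htabs hr0 hr1 (T ω)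
  have hM : 0 < E.towerMoment (magicWeight t) δ r := UVLinear.towerMoment_pos E hE htabs hδ r
  have hMdef : E.towerMoment (magicWeight t) δ r = ∫ ω, g ω ∂E.P := rfl
  have hAi : Integrable A E.P := UVLinear.integrable_nestingWeight_cone E hE hδ t hr0 hr1
  constructor
  · -- LOWER: tilted Jensen on `X = −√3 Θ − Θ₂/c`
    set X : E.Ω → ℝ := fun ω ↦ -(Real.sqrt 3 * Θ ω) - Θ₂ ω / c with hX
    have hgX_eq : (fun ω ↦ g ω * X ω) = fun ω ↦ -(Real.sqrt 3) * (g ω * Θ ω) - g ω * Θ₂ ω / c := by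
      funext ω; simp only [hX]; ring
    have hgX : Integrable (fun ω ↦ g ω * X ω) E.P := by
      rw [hgX_eq]; exact (hiΘ.const_mul _).sub (hiΘ₂.div_const c)
    have hint : ∫ ω, g ω * X ω ∂E.P =
        -(Real.sqrt 3) * ∫ ω, g ω * Θ ω ∂E.P - (∫ ω, g ω * Θ₂ ω ∂E.P) / c := by
      rw [hgX_eq, integral_sub (hiΘ.const_mul _) (hiΘ₂.div_const c), integral_const_mul, integral_div]
    have hJ := UVLinear.mul_exp_div_le_integral hg0
      (ConeTilt.integrable_pow_towerCount_of_nonneg E hE _ hδ 0 r 1 hw0) hgX (hMdef ▸ hM) hAi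
      fun ω ↦ by rw [hA ω]; exact mul_le_mul_of_nonneg_left (hUV ω).1 (hg0 ω)
    rw [← hMdef] at hJ
    -- the tilted mean of `X` is `≥ √3 t m − K₁`
    have hmean : Real.sqrt 3 * t * meanTower E δ r - K₁ ≤
        (∫ ω, g ω * X ω ∂E.P) / E.towerMoment (magicWeight t) δ r := by
      rw [le_div_iff₀ hM, hint, hK₁]
      have h3 : 0 < Real.sqrt 3 := Real.sqrt_pos.2 (by norm_num)
      have e1 : Real.sqrt 3 * ∫ ω, g ω * Θ ω ∂E.P ≤
          Real.sqrt 3 * ((C₁ - t * meanTower E δ r) * E.towerMoment (magicWeight t) δ r) :=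
        mul_le_mul_of_nonneg_left hmΘ h3.le
      have e2 : (∫ ω, g ω * Θ₂ ω ∂E.P) / c ≤ C₁ * E.towerMoment (magicWeight t) δ r / c :=
        div_le_div_of_nonneg_right hmΘ₂ hcpos.le
      have e3 : C₁ * E.towerMoment (magicWeight t) δ r / c = C₁ / c * E.towerMoment (magicWeight t) δ r := by
        ring
      linarith [e1, e2, e3]
    calc r ^ η * (E.towerMoment (magicWeight t) δ r * Real.exp (Real.sqrt 3 * t * meanTower E δ r))
        ≤ Real.exp (-K₁) *
            (E.towerMoment (magicWeight t) δ r * Real.exp (Real.sqrt 3 * t * meanTower E δ r)) :=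
          mul_le_mul_of_nonneg_right (hsm.le.trans (min_le_left _ _)) (by positivity)
      _ = E.towerMoment (magicWeight t) δ r * Real.exp (Real.sqrt 3 * t * meanTower E δ r - K₁) := by
          rw [Real.exp_sub, Real.exp_neg]; ring
      _ ≤ E.towerMoment (magicWeight t) δ r *
            Real.exp ((∫ ω, g ω * X ω ∂E.P) / E.towerMoment (magicWeight t) δ r) :=
          mul_le_mul_of_nonneg_left (Real.exp_le_exp.2 hmean) hM.le
      _ ≤ ∫ ω, A ω ∂E.P := hJ
  · -- UPPER: monotonicity
    have hmax : max C₂ 1 ≤ r ^ (-η) := by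
      rw [Real.rpow_neg hr0.le]
      exact (le_inv_comm₀ hK₂ hrη).2 (hsm.le.trans (min_le_right _ _))
    calc ∫ ω, A ω ∂E.P
        ≤ ∫ ω, g ω * Real.exp (-(Real.sqrt 3 * Θ ω)) ∂E.P :=
          integral_mono_of_nonneg (Eventually.of_forall fun ω ↦
              ConeTilt.cone_nestingWeight_nonneg (𝔠 := coneCloud t r) rfl htabs.le hr0 _) hiE
            (Eventually.of_forall fun ω ↦ by
              rw [hA ω]; exact mul_le_mul_of_nonneg_left (hUV ω).2 (hg0 ω))
      _ ≤ C₂ * Real.exp (Real.sqrt 3 * t * meanTower E δ r) * E.towerMoment (magicWeight t) δ r := hmE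
      _ ≤ r ^ (-η) * Real.exp (Real.sqrt 3 * t * meanTower E δ r) * E.towerMoment (magicWeight t) δ r := by
          gcongr; exact (le_max_left _ _).trans hmax
      _ = _ := by ring

end Summit.CriticalPhenomena.CardyFormulaZ2.Cruxes.NestingRigidity.RingCloudTomography

end
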